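import Mathlib
import HarnessLib

/-!
# The Faà di Bruno bound for GEOMETRIC jets: `‖Dⁱg‖ ≤ A·i!·ρⁱ`, `‖Dⁱf‖ ≤ d·ρ^{i−1}` ⇒ `‖Dⁿ(g ∘ f)‖ ≤ n!·(A·n!)·(max(d,1)·ρ)ⁿ`

Topic `Analysis/Calculus`; companion of `IteratedDifferenceMixedBound` / `IteratedDifferenceDerivBound`.  Mathlib's
`norm_iteratedFDeriv_comp_le` bounds `‖Dⁿ(g ∘ f)(x)‖ ≤ n!·C·Dⁿ` from a UNIFORM bound `‖Dⁱg(f x)‖ ≤ C` (`i ≤ n`) and PURE-POWER bounds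
`‖Dⁱf(x)‖ ≤ Dⁱ` (`1 ≤ i ≤ n`).  For a single-scale propagator symbol composed with a renormalised band (Benfatto–Giuliani–Mastropietro 2006,
(2.36aa), §3 (3.2)–(3.8): `Ψ(ω, e_K(p))` with `‖∂_eⁱΨ‖ ≍ i!·(2/max(|ω|,Λ/2))^{i+1}` and a frame band whose jets are themselves multi-scale,
`‖Dⁱe_K‖ ≲ 7` for `i ≤ 2` but `≍ Λ^{−(i−2)}` beyond) both hypotheses are GEOMETRIC in the order with a common ratio `ρ ≍ 1/Λ`, and the
one-scale reading (`C` = the top order, `D ≍ ρ^{1/2}`-type compromises) loses powers of `ρ`.  The sharp statement costs nothing: RESCALE the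
intermediate variable by `ρ` — `g ∘ f = g_ρ ∘ f_ρ` with `f_ρ = ρ·f` (pure-power jets `(max(d,1)ρ)ⁱ`) and `g_ρ = g(ρ⁻¹·)` (uniform jets `A·n!`) —
and apply Mathlib's bound:

* `norm_iteratedFDeriv_comp_smul_le` — `‖Dⁱ(y ↦ g(c•y))(y)‖ ≤ |c|ⁱ·‖Dⁱg(c•y)‖`;
* **`norm_iteratedFDeriv_comp_le_of_geometric`** — `‖Dⁿ(g∘f)(x)‖ ≤ n!·(A·n!)·(max(d,1)·ρ)ⁿ` from `‖Dⁱg(f x)‖ ≤ A·i!·ρⁱ` (`i ≤ n`) and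
  `‖Dⁱf(x)‖ ≤ d·ρ^{i−1}` (`1 ≤ i ≤ n`), `0 < ρ`: ONE clean factor `ρⁿ`;
* **`norm_iteratedFDeriv_comp_mul_le_of_geometric`** — with a second factor `κ` (`‖D^{b−j}κ(x)‖ ≤ W_{b−j}`): the Leibniz form
  `‖Dᵇ((g∘f)·κ)(x)‖ ≤ Σ_{j≤b} C(b,j)·(j!·(A·j!)·(max(d,1)ρ)ʲ)·W_{b−j}` — ONE `κ`-jet per term (the shape of the mean-value integrand `∂_eΨ(ω,e_s)·(e₁−e₀)` of a
  band increment).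

Everything is proved; no definitions; no named facts.

## Sources

G. Benfatto, A. Giuliani, V. Mastropietro, Ann. Henri Poincaré 7 (2006) 809–898, (2.36aa), §3 (3.2)–(3.8) (`BenfattoGiulianiMastropietro2006`);
the Faà di Bruno bound is Mathlib's `norm_iteratedFDeriv_comp_le`.
-/

noncomputable section

namespace Literature.Analysis.Calculus

open Set
open scoped Nat

variable {E F G : Type*} [NormedAddCommGroup E] [NormedSpace ℝ E] [NormedAddCommGroup F] [NormedSpace ℝ F]
  [NormedAddCommGroup G] [NormedSpace ℝ G]

/-- **Scaling the argument of the outer function**: `‖Dⁱ(y ↦ g(c•y))(y)‖ ≤ |c|ⁱ·‖Dⁱg(c•y)‖` (composition with the linear map `c•id` on the right).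
[cite: BenfattoGiulianiMastropietro2006, (2.36aa)] -/
theorem norm_iteratedFDeriv_comp_smul_le {g : F → G} {N : WithTop ℕ∞} (hg : ContDiff ℝ N g) (c : ℝ) (y : F) {i : ℕ} (hi : (i : WithTop ℕ∞) ≤ N) :
    ‖iteratedFDeriv ℝ i (fun y => g (c • y)) y‖ ≤ |c| ^ i * ‖iteratedFDeriv ℝ i g (c • y)‖ := by
  have hfun : (fun y => g (c • y)) = g ∘ ⇑(c • ContinuousLinearMap.id ℝ F) := by
    funext z; simp
  rw [hfun, ContinuousLinearMap.iteratedFDeriv_comp_right _ hg y hi]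
  refine (ContinuousMultilinearMap.norm_compContinuousLinearMap_le _ _).trans ?_
  rw [Finset.prod_const, Finset.card_univ, Fintype.card_fin, mul_comm]
  have hc : ‖c • ContinuousLinearMap.id ℝ F‖ ≤ |c| := by
    refine (norm_smul_le c (ContinuousLinearMap.id ℝ F)).trans ?_
    rw [Real.norm_eq_abs]
    exact mul_le_of_le_one_right (abs_nonneg c) ContinuousLinearMap.norm_id_le
  have h1 : (c • ContinuousLinearMap.id ℝ F) y = c • y := by simp
  rw [h1]
  exact mul_le_mul_of_nonneg_right (pow_le_pow_left₀ (norm_nonneg _) hc i) (norm_nonneg _)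

/-- **The Faà di Bruno bound for GEOMETRIC jets.**  If `‖Dⁱg(f x)‖ ≤ A·i!·ρⁱ` for `i ≤ n` and `‖Dⁱf(x)‖ ≤ d·ρ^{i−1}` for `1 ≤ i ≤ n` (`0 < ρ`), then
`‖Dⁿ(g ∘ f)(x)‖ ≤ n!·(A·n!)·(max(d,1)·ρ)ⁿ` — one clean factor `ρⁿ` (rescale the intermediate variable by `ρ`, then Mathlib's `norm_iteratedFDeriv_comp_le`).
[cite: BenfattoGiulianiMastropietro2006, §3 (3.2)] -/
theorem norm_iteratedFDeriv_comp_le_of_geometric {g : F → G} {f : E → F} {n : ℕ} {N : WithTop ℕ∞} (hg : ContDiff ℝ N g) (hf : ContDiff ℝ N f)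
    (hn : (n : WithTop ℕ∞) ≤ N) (x : E) {A ρ d : ℝ} (hρ : 0 < ρ)
    (hC : ∀ i ≤ n, ‖iteratedFDeriv ℝ i g (f x)‖ ≤ A * i ! * ρ ^ i)
    (hD : ∀ i, 1 ≤ i → i ≤ n → ‖iteratedFDeriv ℝ i f x‖ ≤ d * ρ ^ (i - 1)) :
    ‖iteratedFDeriv ℝ n (g ∘ f) x‖ ≤ n ! * (A * n !) * (max d 1 * ρ) ^ n := by
  have hA : 0 ≤ A := by
    have h0 := hC 0 (Nat.zero_le _)
    simp only [Nat.factorial_zero, Nat.cast_one, mul_one, pow_zero] at h0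
    exact (norm_nonneg _).trans h0
  -- the rescaled pair
  set fρ : E → F := fun z => ρ • f z with hfρ
  set gρ : F → G := fun y => g (ρ⁻¹ • y) with hgρ
  have hcomp : g ∘ f = gρ ∘ fρ := by
    funext z
    simp only [Function.comp_apply, hgρ, hfρ, smul_smul, inv_mul_cancel₀ hρ.ne', one_smul]
  have hfρc : ContDiff ℝ N fρ := contDiff_const.smul hf
  have hgρc : ContDiff ℝ N gρ := hg.comp (contDiff_const.smul contDiff_id)
  have hfx : ρ⁻¹ • fρ x = f x := by simp only [hfρ, smul_smul, inv_mul_cancel₀ hρ.ne', one_smul]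
  rw [hcomp]
  refine norm_iteratedFDeriv_comp_le hgρc hfρc hn x (C := A * n !) (D := max d 1 * ρ) (fun i hi => ?_) (fun i hi1 hi2 => ?_)
  · -- outer: `‖Dⁱgρ(fρ x)‖ ≤ ρ^{-i}·A·i!·ρ^i = A·i! ≤ A·n!`
    have hiN : (i : WithTop ℕ∞) ≤ N := le_trans (by exact_mod_cast hi) hn
    calc ‖iteratedFDeriv ℝ i gρ (fρ x)‖ ≤ |ρ⁻¹| ^ i * ‖iteratedFDeriv ℝ i g (ρ⁻¹ • fρ x)‖ :=
          norm_iteratedFDeriv_comp_smul_le hg ρ⁻¹ (fρ x) hiN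
      _ ≤ |ρ⁻¹| ^ i * (A * i ! * ρ ^ i) := by rw [hfx]; exact mul_le_mul_of_nonneg_left (hC i hi) (by positivity)
      _ = A * i ! := by
          rw [abs_of_pos (inv_pos.2 hρ), inv_pow]
          field_simp
      _ ≤ A * n ! := by
          exact mul_le_mul_of_nonneg_left (by exact_mod_cast Nat.factorial_le hi) hA
  · -- inner: `‖Dⁱfρ(x)‖ = ρ‖Dⁱf(x)‖ ≤ d·ρ^i ≤ (max d 1·ρ)^i`
    have hiN : (i : WithTop ℕ∞) ≤ N := le_trans (by exact_mod_cast hi2) hn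
    have hsm : iteratedFDeriv ℝ i fρ x = ρ • iteratedFDeriv ℝ i f x := by
      rw [hfρ]
      exact iteratedFDeriv_const_smul_apply' ((hf.of_le hiN).contDiffAt)
    rw [hsm, norm_smul, Real.norm_of_nonneg hρ.le]
    have hd1 : d ≤ max d 1 ^ i := by
      calc d ≤ max d 1 := le_max_left _ _
        _ = max d 1 ^ 1 := (pow_one _).symm
        _ ≤ max d 1 ^ i := pow_le_pow_right₀ (le_max_right _ _) hi1
    calc ρ * ‖iteratedFDeriv ℝ i f x‖ ≤ ρ * (d * ρ ^ (i - 1)) := mul_le_mul_of_nonneg_left (hD i hi1 hi2) hρ.le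
      _ = d * ρ ^ i := by
          obtain ⟨j, rfl⟩ := Nat.exists_eq_add_of_le hi1
          rw [Nat.add_sub_cancel_left, pow_add, pow_one]; ring
      _ ≤ max d 1 ^ i * ρ ^ i := mul_le_mul_of_nonneg_right hd1 (by positivity)
      _ = (max d 1 * ρ) ^ i := by rw [mul_pow]

/-- **Leibniz form with a second factor** (the mean-value integrand of a band increment: ONE `κ`-jet per term): for `g : F → 𝔸`, `κ : E → 𝔸` in a normed
algebra, under the geometric hypotheses on `g` and `f` at every order `≤ b` and `‖Dⁱκ(x)‖ ≤ Wᵢ` (`i ≤ b`),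
`‖Dᵇ((g∘f)·κ)(x)‖ ≤ Σ_{j≤b} C(b,j)·(j!·(A·j!)·(max(d,1)ρ)ʲ)·W_{b−j}`. [cite: BenfattoGiulianiMastropietro2006, §3 (3.2)] -/
theorem norm_iteratedFDeriv_comp_mul_le_of_geometric {𝔸 : Type*} [NormedRing 𝔸] [NormedAlgebra ℝ 𝔸] {g : F → 𝔸} {f : E → F} {κ : E → 𝔸}
    {b : ℕ} {N : WithTop ℕ∞} (hg : ContDiff ℝ N g) (hf : ContDiff ℝ N f) (hκ : ContDiff ℝ N κ) (hb : (b : WithTop ℕ∞) ≤ N) (x : E) {A ρ d : ℝ}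
    (hρ : 0 < ρ) (hC : ∀ i ≤ b, ‖iteratedFDeriv ℝ i g (f x)‖ ≤ A * i ! * ρ ^ i)
    (hD : ∀ i, 1 ≤ i → i ≤ b → ‖iteratedFDeriv ℝ i f x‖ ≤ d * ρ ^ (i - 1)) {W : ℕ → ℝ}
    (hW : ∀ i ≤ b, ‖iteratedFDeriv ℝ i κ x‖ ≤ W i) :
    ‖iteratedFDeriv ℝ b (fun z => g (f z) * κ z) x‖ ≤
      ∑ j ∈ Finset.range (b + 1), (b.choose j : ℝ) * (j ! * (A * j !) * (max d 1 * ρ) ^ j) * W (b - j) := by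
  have hgf : ContDiff ℝ N (fun z => g (f z)) := hg.comp hf
  refine (norm_iteratedFDeriv_mul_le hgf hκ x hb).trans (Finset.sum_le_sum fun j hj => ?_)
  have hjb : j ≤ b := Nat.lt_succ_iff.1 (Finset.mem_range.1 hj)
  have hjN : (j : WithTop ℕ∞) ≤ N := le_trans (by exact_mod_cast hjb) hb
  have h1 : ‖iteratedFDeriv ℝ j (fun z => g (f z)) x‖ ≤ j ! * (A * j !) * (max d 1 * ρ) ^ j :=
    norm_iteratedFDeriv_comp_le_of_geometric hg hf hjN x hρ (fun i hi => hC i (hi.trans hjb)) (fun i hi1 hi2 => hD i hi1 (hi2.trans hjb))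
  have h2 : ‖iteratedFDeriv ℝ (b - j) κ x‖ ≤ W (b - j) := hW _ (Nat.sub_le _ _)
  have hA : 0 ≤ A := by
    have h0 := hC 0 (Nat.zero_le _)
    simp only [Nat.factorial_zero, Nat.cast_one, mul_one, pow_zero] at h0
    exact (norm_nonneg _).trans h0
  calc (b.choose j : ℝ) * ‖iteratedFDeriv ℝ j (fun z => g (f z)) x‖ * ‖iteratedFDeriv ℝ (b - j) κ x‖
      ≤ (b.choose j : ℝ) * (j ! * (A * j !) * (max d 1 * ρ) ^ j) * W (b - j) := by
        have h0 : 0 ≤ j ! * (A * j !) * (max d 1 * ρ) ^ j :=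
          mul_nonneg (mul_nonneg (by positivity) (mul_nonneg hA (by positivity))) (pow_nonneg (mul_nonneg (le_trans zero_le_one (le_max_right _ _)) hρ.le) _)
        exact mul_le_mul (mul_le_mul_of_nonneg_left h1 (by positivity)) h2 (norm_nonneg _) (mul_nonneg (by positivity) h0)

end Literature.Analysis.Calculus

end
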